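import Summits.KontsevichZagierPeriods.Zeta5Search.RecurrenceCertificateRates
import HarnessLib

/-!
# ζ(5) search — FORMAT A′ + Poincaré: the EXACT DECAY rate of the forms of a recurrence certificate (cell `pub-zeta5`, TYPER)

HONEST FRAMING: systematic search; no irrationality claim unless certified.

Sequel of `RecurrenceCertificateRates.lean` (exact GROWTH `log uₙ/n → log λ∞` and the sharp
exponent). Here the DECAY side is made exact, by an argument that needs no analysis of the forms
themselves: for a `RecurrenceCertificate R` (order 2, `tₙ > 0`) the steps
`dₙ = v_{n+1}/u_{n+1} - vₙ/uₙ = Wₙ/(uₙu_{n+1})` (`Wₙ` the Casoratian, `W_{n+1} = tₙWₙ` by Abel) all have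
THE SAME SIGN from `N` on and shrink geometrically (`|d_{n+1}| ≤ θ|dₙ|`, `θ = τ/λ² < 1` by the
certificate's margin), so the tail `ξ - vₙ/uₙ = Σ_{k ≥ n} d_k` is squeezed:

* `abs_step_le_abs_err`, `abs_err_le` — `|dₙ| ≤ |ξ - vₙ/uₙ| ≤ |dₙ|/(1 - θ)` for `n ≥ N`
  (in particular `uₙξ - vₙ ≠ 0` for EVERY `n ≥ N`, `form_ne_zero`);
* with Poincaré data `D : R.LimitData` and `tₙ → b > 0`:
  `tendsto_log_abs_err_div` — `log|ξ - vₙ/uₙ|/n → log b - 2 log λ∞`, and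
  `tendsto_log_abs_form_div` — `log|uₙξ - vₙ|/n → log b - log λ∞`: the exact decay rate of the
  forms (Apéry: `-log(17+12√2) = -3.5255`, i.e. `|bₙζ(3) - aₙ|^{1/n} → (√2-1)⁴`);
  `tendsto_root_abs_form` — `|uₙξ - vₙ|^{1/n} → b/λ∞`.

So for an order-2 family certified in FORMAT A′ ALL the rates of `CRITERIA.md` §0 (growth `b`,
decay `c`, hence the margin and the exponent) are theorems once the two coefficient limits are.
Everything is PROVED (0 sorry).
-/

noncomputable section

open Filter Topology Finset
open Literature.Analysis.Asymptotics.PoincareRecurrence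

namespace Summit.KontsevichZagierPeriods.Zeta5Search

namespace RecurrenceCertificate

variable {ξ : ℝ} (R : RecurrenceCertificate ξ)

/-! ### The Casoratian steps -/

/-- The Casoratian `Wₙ = uₙv_{n+1} - u_{n+1}vₙ` over `ℝ`. -/
def casR (n : ℕ) : ℝ := (R.u n : ℝ) * R.v (n + 1) - R.u (n + 1) * R.v n

/-- The step `dₙ = v_{n+1}/u_{n+1} - vₙ/uₙ`. -/
def stepR (n : ℕ) : ℝ := (R.v (n + 1) : ℝ) / R.u (n + 1) - (R.v n : ℝ) / R.u n

/-- The error `eₙ = ξ - vₙ/uₙ`. -/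
def errR (n : ℕ) : ℝ := ξ - (R.v n : ℝ) / R.u n

/-- The contraction ratio `θ = τ/λ²` of the steps. -/
def theta : ℝ := (R.tau : ℝ) / (R.lam : ℝ) ^ 2

/-- `uₙ > 0` for `n ≥ N` (from the box). -/
theorem u_real_pos (n : ℕ) (hn : R.N ≤ n) : (0 : ℝ) < R.u n := (R.ratio_bounds n hn).1

/-- `dₙ = Wₙ/(uₙu_{n+1})` for `n ≥ N`. -/
theorem stepR_eq (n : ℕ) (hn : R.N ≤ n) : R.stepR n = R.casR n / ((R.u n : ℝ) * R.u (n + 1)) := by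
  have h0 := (R.u_real_pos n hn).ne'
  have h1 := (R.u_real_pos (n + 1) (by omega)).ne'
  unfold stepR casR
  field_simp

/-- Abel: `W_{n+1} = tₙWₙ` for `n ≥ N`. -/
theorem casR_succ (n : ℕ) (hn : R.N ≤ n) : R.casR (n + 1) = (R.t n : ℝ) * R.casR n := by
  unfold casR
  rw [show n + 1 + 1 = n + 2 by ring]
  exact R.casoratian_succ_real n hn

/-- `Wₙ = (∏_{N ≤ i < n} tᵢ) · W_N` for `n ≥ N` (over `ℝ`). -/
theorem casR_eq (n : ℕ) (hn : R.N ≤ n) :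
    R.casR n = (∏ i ∈ Ico R.N n, (R.t i : ℝ)) * R.casR R.N := by
  have h := R.casoratian_eq n hn
  unfold casR
  exact_mod_cast h

/-- `Wₙ ≠ 0` for `n ≥ N`. -/
theorem casR_ne_zero (n : ℕ) (hn : R.N ≤ n) : R.casR n ≠ 0 := R.casoratian_real_ne_zero n hn

/-- **Constant sign**: `W_N · Wₙ > 0` for `n ≥ N`. -/
theorem casR_mul_pos (n : ℕ) (hn : R.N ≤ n) : 0 < R.casR R.N * R.casR n := by
  rw [R.casR_eq n hn]
  have hprod : 0 < ∏ i ∈ Ico R.N n, (R.t i : ℝ) :=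
    prod_pos fun i hi => by exact_mod_cast R.t_pos i (mem_Ico.1 hi).1
  have hW : 0 < R.casR R.N * R.casR R.N := mul_self_pos.2 (R.casR_ne_zero R.N le_rfl)
  nlinarith [mul_pos hprod hW]

/-- `W_N · dₙ > 0` for `n ≥ N` (all steps have the sign of `W_N`). -/
theorem casR_mul_stepR_pos (n : ℕ) (hn : R.N ≤ n) : 0 < R.casR R.N * R.stepR n := by
  rw [R.stepR_eq n hn, ← mul_div_assoc]
  exact div_pos (R.casR_mul_pos n hn) (mul_pos (R.u_real_pos n hn) (R.u_real_pos (n + 1) (by omega)))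

/-- `dₙ ≠ 0` for `n ≥ N`. -/
theorem stepR_ne_zero (n : ℕ) (hn : R.N ≤ n) : R.stepR n ≠ 0 := by
  intro h
  have := R.casR_mul_stepR_pos n hn
  rw [h, mul_zero] at this
  exact lt_irrefl _ this

/-! ### Geometric shrinking of the steps -/

/-- `0 ≤ θ`. -/
theorem theta_nonneg : 0 ≤ R.theta := by
  unfold theta; exact div_nonneg R.tau_pos.le (sq_nonneg _)

/-- `θ < 1` (`τ ≤ e^{δ₀}Λτ < λ²` by the certificate's margin, as `e^{δ₀} ≥ 1`, `Λ ≥ λ > 1`). -/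
theorem theta_lt_one : R.theta < 1 := by
  have hm := R.margin
  have hτ := R.tau_pos
  have hΛ : (1 : ℝ) ≤ R.Lam := by
    have h1 : (1 : ℚ) ≤ R.Lam := le_trans R.one_lt_lam.le R.lam_le
    exact_mod_cast h1
  have he : (1 : ℝ) ≤ Real.exp (∑ i, ((R.c i * R.k i : ℕ) : ℝ)) := by
    have h0 : (0 : ℝ) ≤ ∑ i, ((R.c i * R.k i : ℕ) : ℝ) := by positivity
    linarith [Real.add_one_le_exp (∑ i, ((R.c i * R.k i : ℕ) : ℝ))]
  have h1 : (R.tau : ℝ) ≤ Real.exp (∑ i, ((R.c i * R.k i : ℕ) : ℝ)) * R.Lam * R.tau := by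
    have : (1 : ℝ) ≤ Real.exp (∑ i, ((R.c i * R.k i : ℕ) : ℝ)) * R.Lam := by nlinarith
    nlinarith
  unfold theta
  rw [div_lt_one (pow_pos R.lam_pos 2)]
  linarith

/-- **One step shrinks by `θ`**: `|d_{n+1}| ≤ θ|dₙ|` for `n ≥ N` (`d_{n+1} = dₙ · tₙuₙ/u_{n+2}`,
`tₙ ≤ τ`, `u_{n+2} ≥ λ²uₙ`). -/
theorem abs_stepR_succ_le (n : ℕ) (hn : R.N ≤ n) : |R.stepR (n + 1)| ≤ R.theta * |R.stepR n| := by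
  have hu0 := R.u_real_pos n hn
  have hu1 := R.u_real_pos (n + 1) (by omega)
  have hu2 := R.u_real_pos (n + 2) (by omega)
  have ht : (0 : ℝ) < R.t n := by exact_mod_cast R.t_pos n hn
  have htτ : (R.t n : ℝ) ≤ R.tau := by exact_mod_cast R.t_le n hn
  -- `u (n+2) ≥ λ² u n`
  have hl := R.lam_pos
  have hg1 := (R.ratio_bounds n hn).2.1
  have hg2 := (R.ratio_bounds (n + 1) (by omega)).2.1
  rw [show n + 1 + 1 = n + 2 by ring] at hg2
  have hu2' : (R.lam : ℝ) ^ 2 * R.u n ≤ R.u (n + 2) := by nlinarith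
  -- the step identity
  have hid : R.stepR (n + 1) = R.stepR n * ((R.t n : ℝ) * R.u n / R.u (n + 2)) := by
    rw [R.stepR_eq (n + 1) (by omega), R.stepR_eq n hn, R.casR_succ n hn,
      show n + 1 + 1 = n + 2 by ring]
    field_simp
  rw [hid, abs_mul, mul_comm]
  refine mul_le_mul_of_nonneg_right ?_ (abs_nonneg _)
  rw [abs_of_pos (by positivity)]
  calc (R.t n : ℝ) * R.u n / R.u (n + 2)
      ≤ (R.t n : ℝ) * R.u n / ((R.lam : ℝ) ^ 2 * R.u n) :=
        div_le_div_of_nonneg_left (by positivity) (by positivity) hu2'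
    _ = (R.t n : ℝ) / (R.lam : ℝ) ^ 2 := by field_simp
    _ ≤ R.theta := by unfold theta; exact div_le_div_of_nonneg_right htτ (by positivity)

/-- `|d_{n+j}| ≤ θ^j |dₙ|` for `n ≥ N`. -/
theorem abs_stepR_add_le (n : ℕ) (hn : R.N ≤ n) (j : ℕ) :
    |R.stepR (n + j)| ≤ R.theta ^ j * |R.stepR n| := by
  induction j with
  | zero => simp
  | succ j ih =>
    rw [show n + (j + 1) = n + j + 1 by ring, pow_succ]
    calc |R.stepR (n + j + 1)| ≤ R.theta * |R.stepR (n + j)| := R.abs_stepR_succ_le (n + j) (by omega)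
      _ ≤ R.theta * (R.theta ^ j * |R.stepR n|) := mul_le_mul_of_nonneg_left ih R.theta_nonneg
      _ = R.theta ^ j * R.theta * |R.stepR n| := by ring

/-! ### The two-sided squeeze of the error -/

/-- Partial sums, signed by `W_N`: for `n ≥ N` and every `k`,
`W_N dₙ ≤ W_N (v_{n+1+k}/u_{n+1+k} - vₙ/uₙ) ≤ |W_N||dₙ| (1 - θ^{k+1})/(1 - θ)`. -/
theorem partial_bounds (n : ℕ) (hn : R.N ≤ n) (k : ℕ) :
    R.casR R.N * R.stepR n ≤
        R.casR R.N * ((R.v (k + (n + 1)) : ℝ) / R.u (k + (n + 1)) - (R.v n : ℝ) / R.u n) ∧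
      R.casR R.N * ((R.v (k + (n + 1)) : ℝ) / R.u (k + (n + 1)) - (R.v n : ℝ) / R.u n) ≤
        |R.casR R.N| * |R.stepR n| * (1 - R.theta ^ (k + 1)) / (1 - R.theta) := by
  have hθ0 := R.theta_nonneg
  have hθ1 := R.theta_lt_one
  have h1θ : 0 < 1 - R.theta := by linarith
  induction k with
  | zero =>
    have e : (R.v (0 + (n + 1)) : ℝ) / R.u (0 + (n + 1)) - (R.v n : ℝ) / R.u n = R.stepR n := by
      simp only [zero_add]; rfl
    rw [e]
    refine ⟨le_rfl, ?_⟩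
    rw [zero_add, pow_one, ← abs_mul, abs_of_pos (R.casR_mul_stepR_pos n hn)]
    exact le_of_eq (by field_simp)
  | succ k ih =>
    obtain ⟨ihl, ihu⟩ := ih
    -- split off the last step `d (n+1+k)`
    have e : (R.v (k + 1 + (n + 1)) : ℝ) / R.u (k + 1 + (n + 1)) - (R.v n : ℝ) / R.u n =
        ((R.v (k + (n + 1)) : ℝ) / R.u (k + (n + 1)) - (R.v n : ℝ) / R.u n) + R.stepR (n + (k + 1)) := by
      unfold stepR
      rw [show n + (k + 1) + 1 = k + 1 + (n + 1) by ring, show n + (k + 1) = k + (n + 1) by ring]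
      ring
    rw [e, mul_add]
    have hpos : 0 < R.casR R.N * R.stepR (n + (k + 1)) := R.casR_mul_stepR_pos _ (by omega)
    have hbd : R.casR R.N * R.stepR (n + (k + 1)) ≤ |R.casR R.N| * |R.stepR n| * R.theta ^ (k + 1) := by
      calc R.casR R.N * R.stepR (n + (k + 1)) ≤ |R.casR R.N * R.stepR (n + (k + 1))| := le_abs_self _
        _ = |R.casR R.N| * |R.stepR (n + (k + 1))| := abs_mul _ _
        _ ≤ |R.casR R.N| * (R.theta ^ (k + 1) * |R.stepR n|) :=
            mul_le_mul_of_nonneg_left (R.abs_stepR_add_le n hn (k + 1)) (abs_nonneg _)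
        _ = |R.casR R.N| * |R.stepR n| * R.theta ^ (k + 1) := by ring
    refine ⟨by linarith, ?_⟩
    have halg : |R.casR R.N| * |R.stepR n| * (1 - R.theta ^ (k + 1)) / (1 - R.theta) +
        |R.casR R.N| * |R.stepR n| * R.theta ^ (k + 1) =
        |R.casR R.N| * |R.stepR n| * (1 - R.theta ^ (k + 1 + 1)) / (1 - R.theta) := by
      field_simp
      ring
    linarith

/-- **Lower bound**: `|dₙ| ≤ |ξ - vₙ/uₙ|` for `n ≥ N`. -/
theorem abs_step_le_abs_err (n : ℕ) (hn : R.N ≤ n) : |R.stepR n| ≤ |R.errR n| := by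
  have hlim : Tendsto (fun k : ℕ => R.casR R.N *
      ((R.v (k + (n + 1)) : ℝ) / R.u (k + (n + 1)) - (R.v n : ℝ) / R.u n)) atTop
      (𝓝 (R.casR R.N * R.errR n)) := by
    unfold errR
    exact ((( tendsto_add_atTop_iff_nat (n + 1)).2 R.tendsto_div).sub_const _).const_mul _
  have hge : R.casR R.N * R.stepR n ≤ R.casR R.N * R.errR n :=
    ge_of_tendsto hlim (Eventually.of_forall fun k => (R.partial_bounds n hn k).1)
  have hpos := R.casR_mul_stepR_pos n hn
  have hW : 0 < |R.casR R.N| := abs_pos.2 (R.casR_ne_zero R.N le_rfl)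
  have h1 : |R.casR R.N| * |R.stepR n| ≤ |R.casR R.N| * |R.errR n| := by
    rw [← abs_mul, ← abs_mul, abs_of_pos hpos]
    exact hge.trans (le_abs_self _)
  exact le_of_mul_le_mul_left h1 hW

/-- **Upper bound**: `|ξ - vₙ/uₙ| ≤ |dₙ|/(1 - θ)` for `n ≥ N`. -/
theorem abs_err_le (n : ℕ) (hn : R.N ≤ n) : |R.errR n| ≤ |R.stepR n| / (1 - R.theta) := by
  have hθ0 := R.theta_nonneg
  have hθ1 := R.theta_lt_one
  have h1θ : 0 < 1 - R.theta := by linarith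
  have hlim : Tendsto (fun k : ℕ => R.casR R.N *
      ((R.v (k + (n + 1)) : ℝ) / R.u (k + (n + 1)) - (R.v n : ℝ) / R.u n)) atTop
      (𝓝 (R.casR R.N * R.errR n)) := by
    unfold errR
    exact (((tendsto_add_atTop_iff_nat (n + 1)).2 R.tendsto_div).sub_const _).const_mul _
  have hle : R.casR R.N * R.errR n ≤ |R.casR R.N| * |R.stepR n| / (1 - R.theta) := by
    refine le_of_tendsto hlim (Eventually.of_forall fun k => ((R.partial_bounds n hn k).2).trans ?_)
    have hpow : 0 ≤ R.theta ^ (k + 1) := pow_nonneg hθ0 _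
    have hnum : |R.casR R.N| * |R.stepR n| * (1 - R.theta ^ (k + 1)) ≤ |R.casR R.N| * |R.stepR n| := by
      have : 0 ≤ |R.casR R.N| * |R.stepR n| := by positivity
      nlinarith
    exact div_le_div_of_nonneg_right hnum h1θ.le
  have hge : R.casR R.N * R.stepR n ≤ R.casR R.N * R.errR n :=
    ge_of_tendsto hlim (Eventually.of_forall fun k => (R.partial_bounds n hn k).1)
  have hpos : 0 < R.casR R.N * R.errR n := (R.casR_mul_stepR_pos n hn).trans_le hge
  have hW : 0 < |R.casR R.N| := abs_pos.2 (R.casR_ne_zero R.N le_rfl)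
  have h1 : |R.casR R.N| * |R.errR n| ≤ |R.casR R.N| * (|R.stepR n| / (1 - R.theta)) := by
    rw [← abs_mul, abs_of_pos hpos, ← mul_div_assoc]
    exact hle
  exact le_of_mul_le_mul_left h1 hW

/-- `ξ - vₙ/uₙ ≠ 0` for `n ≥ N`. -/
theorem errR_ne_zero (n : ℕ) (hn : R.N ≤ n) : R.errR n ≠ 0 := by
  intro h
  have h1 := R.abs_step_le_abs_err n hn
  rw [h, abs_zero] at h1
  exact R.stepR_ne_zero n hn (abs_eq_zero.1 (le_antisymm h1 (abs_nonneg _)))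

/-- **The forms never vanish from `N` on**: `uₙξ - vₙ ≠ 0` for every `n ≥ N`. -/
theorem form_ne_zero (n : ℕ) (hn : R.N ≤ n) : (R.u n : ℝ) * ξ - R.v n ≠ 0 := by
  have hu := (R.u_real_pos n hn).ne'
  have he := R.errR_ne_zero n hn
  unfold errR at he
  intro h
  apply he
  field_simp
  linarith

/-- `uₙξ - vₙ = uₙ · (ξ - vₙ/uₙ)` for `n ≥ N`. -/
theorem form_eq (n : ℕ) (hn : R.N ≤ n) : (R.u n : ℝ) * ξ - R.v n = (R.u n : ℝ) * R.errR n := by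
  have hu := (R.u_real_pos n hn).ne'
  unfold errR
  field_simp

namespace LimitData

variable {R} (D : LimitData R)

/-! ### Exact decay rates -/

/-- `log uₙ₊₁ / n → log λ∞` (shifted index). -/
theorem tendsto_log_u_succ_div :
    Tendsto (fun n : ℕ => Real.log (R.u (n + 1) : ℝ) / n) atTop (𝓝 (Real.log D.lam)) := by
  -- `log u (n+1) = log u n + log (u(n+1)/u n)` and the ratio term is bounded
  have h1 : Tendsto (fun n : ℕ => Real.log ((R.u (n + 1) : ℝ) / R.u n)) atTop (𝓝 (Real.log D.lam)) :=
    D.tendsto_ratio.log D.lam_pos.ne'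
  have h2 : Tendsto (fun n : ℕ => Real.log ((R.u (n + 1) : ℝ) / R.u n) / n) atTop (𝓝 0) :=
    h1.div_atTop tendsto_natCast_atTop_atTop
  have h3 := D.tendsto_log_u_div.add h2
  rw [add_zero] at h3
  refine h3.congr' ?_
  filter_upwards [eventually_ge_atTop R.N] with n hn
  have hu0 := R.u_real_pos n hn
  have hu1 := R.u_real_pos (n + 1) (by omega)
  rw [← add_div, Real.log_div hu1.ne' hu0.ne']
  ring

/-- **Exact rate of the steps**: `log|dₙ|/n → log b - 2 log λ∞` (`b > 0`). -/
theorem tendsto_log_abs_stepR_div (hb : 0 < D.b) :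
    Tendsto (fun n : ℕ => Real.log |R.stepR n| / n) atTop (𝓝 (Real.log D.b - 2 * Real.log D.lam)) := by
  have hW := D.tendsto_log_abs_casoratian_div hb.ne'
  rw [abs_of_pos hb] at hW
  have h := (hW.sub D.tendsto_log_u_div).sub D.tendsto_log_u_succ_div
  have e : Real.log D.b - Real.log D.lam - Real.log D.lam = Real.log D.b - 2 * Real.log D.lam := by ring
  rw [e] at h
  refine h.congr' ?_
  filter_upwards [eventually_ge_atTop R.N] with n hn
  have hu0 := R.u_real_pos n hn
  have hu1 := R.u_real_pos (n + 1) (by omega)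
  have hWn := abs_pos.2 (R.casR_ne_zero n hn)
  rw [R.stepR_eq n hn, abs_div, abs_mul, abs_of_pos hu0, abs_of_pos hu1,
    Real.log_div hWn.ne' (mul_pos hu0 hu1).ne', Real.log_mul hu0.ne' hu1.ne']
  unfold casR
  ring

/-- **Exact approximation rate**: `log|ξ - vₙ/uₙ|/n → log b - 2 log λ∞` (`b > 0`). -/
theorem tendsto_log_abs_err_div (hb : 0 < D.b) :
    Tendsto (fun n : ℕ => Real.log |ξ - (R.v n : ℝ) / R.u n| / n) atTop
      (𝓝 (Real.log D.b - 2 * Real.log D.lam)) := by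
  have hθ1 := R.theta_lt_one
  have h1θ : 0 < 1 - R.theta := by linarith
  have hlow := D.tendsto_log_abs_stepR_div hb
  -- upper companion: `(log|dₙ| + log (1/(1-θ)))/n` has the same limit
  have hc : Tendsto (fun n : ℕ => Real.log (1 / (1 - R.theta)) / n) atTop (𝓝 0) :=
    tendsto_const_nhds.div_atTop tendsto_natCast_atTop_atTop
  have hup := hlow.add hc
  rw [add_zero] at hup
  refine tendsto_of_tendsto_of_tendsto_of_le_of_le' hlow hup ?_ ?_
  · filter_upwards [eventually_ge_atTop R.N, eventually_ge_atTop 1] with n hn h1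
    have hn0 : (0 : ℝ) < n := by exact_mod_cast h1
    have hd := abs_pos.2 (R.stepR_ne_zero n hn)
    exact div_le_div_of_nonneg_right (Real.log_le_log hd (R.abs_step_le_abs_err n hn)) hn0.le
  · filter_upwards [eventually_ge_atTop R.N, eventually_ge_atTop 1] with n hn h1
    have hn0 : (0 : ℝ) < n := by exact_mod_cast h1
    have hd := abs_pos.2 (R.stepR_ne_zero n hn)
    have he := abs_pos.2 (R.errR_ne_zero n hn)
    rw [← add_div]
    refine div_le_div_of_nonneg_right ?_ hn0.le
    have h2 := R.abs_err_le n hn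
    rw [← Real.log_mul hd.ne' (by positivity)]
    refine Real.log_le_log he ?_
    unfold errR at h2
    calc |ξ - (R.v n : ℝ) / R.u n| ≤ |R.stepR n| / (1 - R.theta) := h2
      _ = |R.stepR n| * (1 / (1 - R.theta)) := by ring

/-- **Exact decay rate of the forms**: `log|uₙξ - vₙ|/n → log b - log λ∞` (`b > 0`). -/
theorem tendsto_log_abs_form_div (hb : 0 < D.b) :
    Tendsto (fun n : ℕ => Real.log |(R.u n : ℝ) * ξ - R.v n| / n) atTop
      (𝓝 (Real.log D.b - Real.log D.lam)) := by
  have h := D.tendsto_log_u_div.add (D.tendsto_log_abs_err_div hb)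
  have e : Real.log D.lam + (Real.log D.b - 2 * Real.log D.lam) = Real.log D.b - Real.log D.lam := by ring
  rw [e] at h
  refine h.congr' ?_
  filter_upwards [eventually_ge_atTop R.N] with n hn
  have hu := R.u_real_pos n hn
  have he := abs_pos.2 (R.errR_ne_zero n hn)
  rw [R.form_eq n hn, abs_mul, abs_of_pos hu, Real.log_mul hu.ne' he.ne', add_div]
  rfl

/-- **`|uₙξ - vₙ|^{1/n} → b/λ∞`** (`b > 0`). -/
theorem tendsto_root_abs_form (hb : 0 < D.b) :
    Tendsto (fun n : ℕ => |(R.u n : ℝ) * ξ - R.v n| ^ (1 / (n : ℝ))) atTop (𝓝 (D.b / D.lam)) := by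
  have h1 := (Real.continuous_exp.tendsto _).comp (D.tendsto_log_abs_form_div hb)
  rw [← Real.log_div hb.ne' D.lam_pos.ne', Real.exp_log (div_pos hb D.lam_pos)] at h1
  refine h1.congr' ?_
  filter_upwards [eventually_ge_atTop R.N] with n hn
  have hf := abs_pos.2 (R.form_ne_zero n hn)
  simp only [Function.comp]
  rw [Real.rpow_def_of_pos hf]
  congr 1
  ring

end LimitData

end RecurrenceCertificate

end Summit.KontsevichZagierPeriods.Zeta5Search
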